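import Mathlib.Topology.MetricSpace.Holder
import Mathlib.Topology.Algebra.InfiniteSum.Real
import Mathlib.Analysis.Normed.Group.Basic
import Mathlib.Analysis.SpecialFunctions.Pow.Real
import Literature.Analysis.FunctionSpaces.HolderNorm
import HarnessLib

/-!
# Hölder bounds for pointwise limits of sequences with summable Hölder increments

Generic support lemma for the limit steps of convex-integration schemes (De Lellis–Kwon 2022,
§2.2: "`‖v_{q'} - v_q‖_{C⁰_tC^β_x} ≤ ∑ ‖v_{q+l} - v_{q+l-1}‖_{C^β} ≲ ∑ λ_{q+1}^{β-α} → 0` ...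
Therefore, we obtain its limit `v` in `C⁰([0,T]; C^β(T³))`"; Buckmaster–De Lellis–Székelyhidi–Vicol
2019, §2.2): if `f_n → g` pointwise on a set `s`, `f₀` satisfies a Hölder-type bound
`‖f₀ x - f₀ y‖ ≤ K₀ d(x,y)^r` on `s`, and the increments `f_{n+1} - f_n` satisfy such bounds with
summable constants `K_n ≥ 0`, then `‖g x - g y‖ ≤ (K₀ + ∑ K_n) d(x,y)^r` on `s`
(`norm_sub_le_of_tendsto_of_increments`), i.e. `g` is `r`-Hölder on `s`
(`holderOnWith_of_tendsto_of_increments`). The Hölder bounds of the increments themselves come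
from interpolating sup and Lipschitz bounds (the tree's `BDSV.norm_sub_le_interpolate`,
`OnsagerFlexibilityProofs`).

## References

* C. De Lellis, H. Kwon, Anal. PDE 15 (2022) = arXiv:2006.06482, §2.2. [DelellisKwon2022]
* T. Buckmaster, C. De Lellis, L. Székelyhidi Jr., V. Vicol, CPAM 72 (2019), §2.2.
-/

noncomputable section

open Filter Set
open scoped Topology NNReal ENNReal

namespace Literature.Analysis.FunctionSpaces

/-- **Telescoping Hölder bounds pass to pointwise limits.** Let `f_n → g` pointwise on `s`,
`‖f₀ x - f₀ y‖ ≤ K₀ d(x,y)^r` and `‖(f_{n+1} - f_n) x - (f_{n+1} - f_n) y‖ ≤ K_n d(x,y)^r` for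
`x, y ∈ s`, with `K_n ≥ 0` summable. Then `‖g x - g y‖ ≤ (K₀ + ∑ K_n) d(x,y)^r` on `s`
(telescope `f_N = f₀ + ∑_{n<N} (f_{n+1} - f_n)` and let `N → ∞`). [cite: DelellisKwon2022, §2.2] -/
theorem norm_sub_le_of_tendsto_of_increments {X Y : Type*} [PseudoMetricSpace X]
    [NormedAddCommGroup Y] {s : Set X} {f : ℕ → X → Y} {g : X → Y} {K : ℕ → ℝ} {K₀ r : ℝ}
    (hlim : ∀ x ∈ s, Tendsto (fun n => f n x) atTop (𝓝 (g x)))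
    (h0 : ∀ x ∈ s, ∀ y ∈ s, ‖f 0 x - f 0 y‖ ≤ K₀ * dist x y ^ r)
    (hinc : ∀ n, ∀ x ∈ s, ∀ y ∈ s,
      ‖(f (n + 1) x - f n x) - (f (n + 1) y - f n y)‖ ≤ K n * dist x y ^ r)
    (hK0 : ∀ n, 0 ≤ K n) (hK : Summable K) {x y : X} (hx : x ∈ s) (hy : y ∈ s) :
    ‖g x - g y‖ ≤ (K₀ + ∑' n, K n) * dist x y ^ r := by
  have hd : 0 ≤ dist x y ^ r := Real.rpow_nonneg dist_nonneg r
  -- the bound for every `f N`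
  have hN : ∀ N, ‖f N x - f N y‖ ≤ (K₀ + ∑' n, K n) * dist x y ^ r := by
    intro N
    have htel : f N x - f N y =
        (f 0 x - f 0 y) + ∑ n ∈ Finset.range N, ((f (n + 1) x - f n x) - (f (n + 1) y - f n y)) := by
      have h := Finset.sum_range_sub (fun n => f n x - f n y) N
      have e : ∀ n, (f (n + 1) x - f (n + 1) y) - (f n x - f n y) =
          (f (n + 1) x - f n x) - (f (n + 1) y - f n y) := fun n => by abel
      simp only [e] at h
      rw [h]; abel
    rw [htel]
    calc ‖(f 0 x - f 0 y) + ∑ n ∈ Finset.range N, ((f (n + 1) x - f n x) - (f (n + 1) y - f n y))‖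
        ≤ ‖f 0 x - f 0 y‖ +
            ∑ n ∈ Finset.range N, ‖(f (n + 1) x - f n x) - (f (n + 1) y - f n y)‖ :=
          (norm_add_le _ _).trans (add_le_add le_rfl (norm_sum_le _ _))
      _ ≤ K₀ * dist x y ^ r + ∑ n ∈ Finset.range N, K n * dist x y ^ r :=
          add_le_add (h0 x hx y hy) (Finset.sum_le_sum fun n _ => hinc n x hx y hy)
      _ = (K₀ + ∑ n ∈ Finset.range N, K n) * dist x y ^ r := by
          rw [add_mul, Finset.sum_mul]
      _ ≤ (K₀ + ∑' n, K n) * dist x y ^ r := by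
          gcongr
          exact hK.sum_le_tsum _ fun n _ => hK0 n
  -- pass to the limit `N → ∞`
  have ht : Tendsto (fun N => ‖f N x - f N y‖) atTop (𝓝 ‖g x - g y‖) :=
    ((hlim x hx).sub (hlim y hy)).norm
  exact le_of_tendsto' ht hN

/-- A real Hölder-type bound on a set is Mathlib's `HolderOnWith`. [folklore] -/
theorem holderOnWith_of_norm_sub_le {X Y : Type*} [PseudoMetricSpace X] [NormedAddCommGroup Y]
    {s : Set X} {f : X → Y} {K : ℝ} {r : ℝ≥0} (hK : 0 ≤ K)
    (h : ∀ x ∈ s, ∀ y ∈ s, ‖f x - f y‖ ≤ K * dist x y ^ (r : ℝ)) :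
    HolderOnWith (Real.toNNReal K) r f s := by
  intro x hx y hy
  rw [edist_dist, edist_dist, ENNReal.ofReal_rpow_of_nonneg dist_nonneg r.coe_nonneg,
    ← ENNReal.ofReal_coe_nnreal, Real.coe_toNNReal K hK, ← ENNReal.ofReal_mul hK, dist_eq_norm]
  exact ENNReal.ofReal_le_ofReal (h x hx y hy)

/-- **Pointwise limits of sequences with summable Hölder increments are Hölder** on the set:
under the hypotheses of `norm_sub_le_of_tendsto_of_increments` with `0 ≤ K₀` and `r : ℝ≥0`,
`g` is `r`-Hölder on `s` with constant `K₀ + ∑ K_n`. For space–time fields on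
`[0,T] × T^d` (`X = ℝ × T^d` with the product metric, `s = [0,T] × T^d`) this is the tree's
`FunctionSpaces.HolderOnSpaceTime` of the limit (De Lellis–Kwon 2022, §2.2: the limit `v` lies
in `C^β([0,T] × T³)`). [cite: DelellisKwon2022, §2.2] -/
theorem holderOnWith_of_tendsto_of_increments {X Y : Type*} [PseudoMetricSpace X]
    [NormedAddCommGroup Y] {s : Set X} {f : ℕ → X → Y} {g : X → Y} {K : ℕ → ℝ} {K₀ : ℝ}
    {r : ℝ≥0} (hlim : ∀ x ∈ s, Tendsto (fun n => f n x) atTop (𝓝 (g x)))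
    (h0 : ∀ x ∈ s, ∀ y ∈ s, ‖f 0 x - f 0 y‖ ≤ K₀ * dist x y ^ (r : ℝ))
    (hinc : ∀ n, ∀ x ∈ s, ∀ y ∈ s,
      ‖(f (n + 1) x - f n x) - (f (n + 1) y - f n y)‖ ≤ K n * dist x y ^ (r : ℝ))
    (hK00 : 0 ≤ K₀) (hK0 : ∀ n, 0 ≤ K n) (hK : Summable K) :
    HolderOnWith (Real.toNNReal (K₀ + ∑' n, K n)) r g s :=
  holderOnWith_of_norm_sub_le (add_nonneg hK00 (tsum_nonneg hK0)) fun _ hx _ hy =>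
    norm_sub_le_of_tendsto_of_increments hlim h0 hinc hK0 hK hx hy

/-- Uniform approximation in the explicit form used by the tree's limit lemmas implies
pointwise convergence on the set. [folklore] -/
theorem tendsto_of_unifTo {X₁ X₂ Y : Type*} [NormedAddCommGroup Y] {S : Set X₁}
    {w : ℕ → X₁ → X₂ → Y} {u : X₁ → X₂ → Y}
    (hw : ∀ ε > (0 : ℝ), ∃ N : ℕ, ∀ q ≥ N, ∀ t ∈ S, ∀ x, ‖w q t x - u t x‖ ≤ ε)
    {t : X₁} (ht : t ∈ S) (x : X₂) : Tendsto (fun q => w q t x) atTop (𝓝 (u t x)) := by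
  rw [Metric.tendsto_atTop]
  intro ε hε
  obtain ⟨N, hN⟩ := hw (ε / 2) (half_pos hε)
  exact ⟨N, fun q hq => by
    rw [dist_eq_norm]; exact (hN q hq t ht x).trans_lt (half_lt_self hε)⟩

/-! ### Interpolated Hölder bounds and the space–time Hölder class of a uniform limit -/

/-- Elementary interpolation `min(A, B) ≤ A^{1-θ} B^θ` for `A, B ≥ 0`, `θ ∈ [0,1]`. [folklore] -/
private theorem min_le_rpow_one_sub_mul_rpow {A B θ : ℝ} (hA : 0 ≤ A) (hB : 0 ≤ B) (hθ₀ : 0 ≤ θ)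
    (hθ₁ : θ ≤ 1) : min A B ≤ A ^ (1 - θ) * B ^ θ := by
  have hsplit : ∀ {C : ℝ}, 0 ≤ C → C = C ^ (1 - θ) * C ^ θ := fun {C} hC => by
    rw [← Real.rpow_add' hC (by norm_num : (1 - θ) + θ ≠ 0), sub_add_cancel, Real.rpow_one]
  rcases le_total A B with hAB | hAB
  · rw [min_eq_left hAB]
    calc A = A ^ (1 - θ) * A ^ θ := hsplit hA
      _ ≤ A ^ (1 - θ) * B ^ θ := by gcongr
  · rw [min_eq_right hAB]
    calc B = B ^ (1 - θ) * B ^ θ := hsplit hB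
      _ ≤ A ^ (1 - θ) * B ^ θ := by gcongr

/-- **Interpolation between a sup bound and a Lipschitz bound on a set** (BDSV 2019, App. A,
(A.3) with `r = 1`; De Lellis–Kwon 2022, §2.2: `‖w‖_{C^β} ≲ ‖w‖₀^{1-β} ‖w‖₁^β`): a map bounded
by `σ` and `L`-Lipschitz on `s` satisfies `‖w x - w y‖ ≤ (2σ)^{1-θ} L^θ d(x,y)^θ` on `s`,
`θ ∈ [0,1]`. [cite: DelellisKwon2022, §2.2] -/
theorem norm_sub_le_interpolate_on {X Y : Type*} [PseudoMetricSpace X] [NormedAddCommGroup Y]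
    {s : Set X} {w : X → Y} {σ : ℝ} {L : ℝ≥0} {θ : ℝ} (hσ : ∀ x ∈ s, ‖w x‖ ≤ σ)
    (hL : LipschitzOnWith L w s) (hθ₀ : 0 ≤ θ) (hθ₁ : θ ≤ 1) {x y : X} (hx : x ∈ s)
    (hy : y ∈ s) : ‖w x - w y‖ ≤ (2 * σ) ^ (1 - θ) * (L : ℝ) ^ θ * dist x y ^ θ := by
  have h1 : ‖w x - w y‖ ≤ 2 * σ := (norm_sub_le _ _).trans (by linarith [hσ x hx, hσ y hy])
  have h2 : ‖w x - w y‖ ≤ L * dist x y := by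
    rw [← dist_eq_norm]
    exact hL.dist_le_mul x hx y hy
  have hσ0 : 0 ≤ 2 * σ := by linarith [norm_nonneg (w x), hσ x hx]
  calc ‖w x - w y‖ ≤ min (2 * σ) (L * dist x y) := le_min h1 h2
    _ ≤ (2 * σ) ^ (1 - θ) * ((L : ℝ) * dist x y) ^ θ :=
        min_le_rpow_one_sub_mul_rpow hσ0 (by positivity) hθ₀ hθ₁
    _ = (2 * σ) ^ (1 - θ) * (L : ℝ) ^ θ * dist x y ^ θ := by
        rw [Real.mul_rpow L.coe_nonneg dist_nonneg]
        ring

/-- **Space–time Hölder regularity of a uniform limit from sup and Lipschitz bounds on the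
increments** (De Lellis–Kwon 2022, §2.2: `v_q → v` with
`∑ ‖v_{q+1} - v_q‖₀^{1-β} ‖v_{q+1} - v_q‖₁^β < ∞`, "Hence `v ∈ C^β([0,T] × T³)`"; the same in time
with the `∂ₜ` bounds). If `v_q → u` uniformly on `[0,T] × T^d`, `v₀` is `β`-Hölder there, and the
increments `v_{q+1} - v_q` are bounded by `σ_q ≥ 0` and `L_q`-Lipschitz on `[0,T] × T^d` (product
metric of `ℝ × T^d`) with `∑ (2σ_q)^{1-β} L_q^β < ∞`, then `u ∈ C^β([0,T] × T^d)` in the sense of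
`FunctionSpaces.HolderOnSpaceTime`, with constant `K₀ + ∑ (2σ_q)^{1-β} L_q^β`.
[cite: DelellisKwon2022, §2.2] -/
theorem holderOnSpaceTime_of_unifLimit {d : Type*} [Fintype d] {F : Type*} [NormedAddCommGroup F]
    {T : ℝ} {β : ℝ≥0} (hβ1 : β ≤ 1) {v : ℕ → ℝ → UnitAddTorus d → F}
    {u : ℝ → UnitAddTorus d → F}
    (hv : ∀ ε > (0 : ℝ), ∃ N : ℕ, ∀ q ≥ N, ∀ t ∈ Icc 0 T, ∀ x, ‖v q t x - u t x‖ ≤ ε)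
    {K₀ : ℝ} (hK₀ : 0 ≤ K₀)
    (h0 : ∀ z ∈ Icc 0 T ×ˢ (univ : Set (UnitAddTorus d)),
      ∀ z' ∈ Icc 0 T ×ˢ (univ : Set (UnitAddTorus d)),
      ‖Function.uncurry (v 0) z - Function.uncurry (v 0) z'‖ ≤ K₀ * dist z z' ^ (β : ℝ))
    {σ : ℕ → ℝ} {L : ℕ → ℝ≥0} (hσ0 : ∀ n, 0 ≤ σ n)
    (hσ : ∀ n, ∀ t ∈ Icc 0 T, ∀ x, ‖v (n + 1) t x - v n t x‖ ≤ σ n)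
    (hL : ∀ n, LipschitzOnWith (L n) (Function.uncurry fun t x => v (n + 1) t x - v n t x)
      (Icc 0 T ×ˢ univ))
    (hsum : Summable fun n => (2 * σ n) ^ (1 - (β : ℝ)) * (L n : ℝ) ^ (β : ℝ)) :
    HolderOnSpaceTime β T u := by
  have hβ0 : (0 : ℝ) ≤ β := β.coe_nonneg
  have hβ1' : (β : ℝ) ≤ 1 := by exact_mod_cast hβ1
  have hK : ∀ n, 0 ≤ (2 * σ n) ^ (1 - (β : ℝ)) * (L n : ℝ) ^ (β : ℝ) := fun n => by
    have := hσ0 n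
    positivity
  refine ⟨_, holderOnWith_of_tendsto_of_increments (f := fun n => Function.uncurry (v n))
    (g := Function.uncurry u) (s := Icc 0 T ×ˢ univ) (fun z hz => ?_) h0
    (fun n z hz z' hz' => ?_) hK₀ hK hsum⟩
  · obtain ⟨t, x⟩ := z
    exact tendsto_of_unifTo hv (mem_prod.1 hz).1 x
  · have h := norm_sub_le_interpolate_on (w := Function.uncurry fun t x => v (n + 1) t x - v n t x)
      (fun w hw => hσ n w.1 (mem_prod.1 hw).1 w.2) (hL n) hβ0 hβ1' hz hz'
    obtain ⟨t, x⟩ := z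
    obtain ⟨t', x'⟩ := z'
    simpa only [Function.uncurry_apply_pair] using h

end Literature.Analysis.FunctionSpaces
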